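import Summits.AtomisticToContinuum.HydrodynamicLimit.Theorems.AntiMazurCoboundariesCorrectorPressureDecayKiferCellTranslation
import Summits.AtomisticToContinuum.HydrodynamicLimit.Theorems.AntiMazurCoboundariesCorrectorPressureDecayKiferFreeSubwindowBound
import Summits.AtomisticToContinuum.HydrodynamicLimit.Theorems.AntiMazurCoboundariesCorrectorPressureDecayKiferFreeCountRatios

/-!
# The collar trick for the product of the free cell measures (line `FirstLemma`, crux stmt-AtomisticToContinuum-14135)

Registered stub `c9_pi_free_torusHardCoreTuples_ge` (lead seat c9, piece (B5) of the thermodynamic step of the Gibbs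
route of the uniform entropy bound), namespace `Summit.AtomisticToContinuum.HydrodynamicLimit.Theorems.KiferCompactification`,
together with the shared definition `c9CellCore` (the core of a cell) and the shared definitions `c9PerSqDist`,
`c9TorusHardCoreTuples` (squared periodic distance of the cube of side `S`; the event "total number `n` and torus hard
core" on tuples of cell configurations).

The blown-up torus cube `(-S/2, S/2]³` is tiled by the `m³` half-open cells `c9Cell S m j` of side `S/m`
(`…KiferCellTranslation.lean`). Let `γ_j = gibbsSpecMeasure 1 z β u (cell j) ∅` be the FREE finite-volume unit-diameter
hard-sphere measure of the cell `j` (activity `z ≥ 0`, Maxwellian marks at `β > 0`), `core_j = c9CellCore S m j` the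
closed box of the points of the cell at coordinatewise distance `≥ 1` from its faces, `collar_j = cell_j \ core_j`, and
`E = c9TorusHardCoreTuples S m n`. Then for every count assignment `k` with `∑_j k_j = n` (and `m ≥ 2`)

  `∏_j e^{-z vol(collar_j)} · γ_{core_j}{N = k_j} ≤ (⊗_j γ_j)(E)`   (`c9_pi_free_torusHardCoreTuples_ge`).

Proof. Let `A_j = {collar_j void} ∩ {N = k_j} ∩ {unit hard core} ∩ {carried by cell_j}`.
* GEOMETRY (`pi_subset_c9TorusHardCoreTuples`): `∏_j A_j ⊆ E`. The counts add up to `n`. Two points of different cells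
  `j ≠ j'`: the first lies in `core_j`, the second in `cell_{j'}`, and in a coordinate `i` with `j i ≠ j' i` the
  intervals `[l_i + 1, l_i + S/m - 1]` and `(l'_i, l'_i + S/m]` give `1 ≤ |d_i| ≤ S - 1`, so the periodic coordinate
  distance `min |d_i| (S - |d_i|)` is `≥ 1` (`one_le_c9PerSqDist_of_mem_core_of_ne`). Two distinct points of the same
  cell are at Euclidean distance `≥ 1` and their coordinates differ by less than `S/m ≤ S/2`, so the periodic distance
  is the Euclidean one (`one_le_c9PerSqDist_of_mem_cell`).
* PRODUCT: `(⊗γ)(∏ A_j) = ∏ γ_j(A_j)` (`Measure.pi_pi`), and the hard core / carrier events have full `γ_j`-measure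
  (`gibbsSpecMeasure_empty_compl_isHardCore_eq_zero`, `gibbsSpecMeasure_empty_compl_count_eq_zero`).
* ONE CELL (`exp_neg_mul_core_count_le_cell`): `e^{-z vol(Λ∖W)} γ_W{N = k} ≤ γ_Λ({Λ∖W void} ∩ {N = k})` for
  `W ⊆ Λ`: consistency of the free specification in `W` (`lintegral_gibbsSpec_gibbsSpecMeasure_empty`) restricted to
  the boundary conditions with no particle above `Λ∖W` and none above `Λᶜ` — these have all their particles above
  `W`, so the specification of `W` does not see them and equals the free law of `W` —, the void bound
  `ofReal_exp_neg_le_gibbsSpecMeasure_empty_void` for `Λ∖W`, and `γ_W` being carried by configurations above `W`.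

References: D. Ruelle, *Statistical Mechanics: Rigorous Results* (1969), §3.4 (corridor/collar arguments for the
thermodynamic limit); H.-O. Georgii, *Gibbs Measures and Phase Transitions* (2nd ed. 2011), Def. 1.23, (1.21).
-/

noncomputable section

open MeasureTheory ProbabilityTheory Set Filter Topology
open scoped ENNReal NNReal

namespace Summit.AtomisticToContinuum.HydrodynamicLimit.Theorems.KiferCompactification

open Literature.MathematicalPhysics.KineticTheory (V3)
open Literature.MathematicalPhysics.KineticTheory.HardSphereDLR (gibbsSpecMeasure gibbsSpecMeasure_apply
  mem_superposeIn_iff hsLocalSpec_ae_isHardCore count_eq_zero_iff' notMem_empty')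
open Literature.Analysis.FluidPDE (IsHardCore HardCoreIn superposeIn gibbsWeight gibbsSpec)
open Literature.Analysis.FunctionSpaces (PointConfig maxwellianBeta)

/-! ## Shared definitions -/

/-- The squared PERIODIC distance of two positions of the cube of side `S` (period `S` in each coordinate; for coordinates
differing by less than `S` the periodic coordinate distance is `min |d| (S - |d|)`): the blow-up by `S` of the torus distance
`‖Torus.reprSym (q - q')‖` of the pre-images. -/
def c9PerSqDist (S : ℝ) (y y' : V3) : ℝ :=
  ∑ i, (min |y i - y' i| (S - |y i - y' i|)) ^ 2

/-- The event, on TUPLES of cell configurations indexed by the `m³` cells, that the superposed configuration is a blown-up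
TORUS hard-sphere configuration of exactly `n` unit spheres: total number of points `n`, and any two distinct points (in the
same or in different cells) at periodic distance `≥ 1`. -/
def c9TorusHardCoreTuples (S : ℝ) (m n : ℕ) : Set ((Fin 3 → Fin m) → PointConfig (V3 × V3)) :=
  {t | (∑ j, (t j).count univ) = n ∧
    ∀ j j' (p q : V3 × V3), p ∈ t j → q ∈ t j' → (j ≠ j' ∨ p ≠ q) → 1 ≤ c9PerSqDist S p.1 q.1}

/-- The CORE of the cell `j`: the closed box of the points of the cell at (coordinatewise) distance `≥ 1` from its faces,
`{y | ∀ i, y i ∈ [-S/2 + jᵢ S/m + 1, -S/2 + (jᵢ+1) S/m - 1]}` (empty when `S/m < 2`). Points of the core are at periodic distance `≥ 1` from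
every point outside the cell. -/
def c9CellCore (S : ℝ) (m : ℕ) (j : Fin 3 → Fin m) : Set V3 :=
  {y | ∀ i, y i ∈ Icc (-S / 2 + ((j i : ℕ) : ℝ) * (S / m) + 1) (-S / 2 + (((j i : ℕ) : ℝ) + 1) * (S / m) - 1)}

/-! ## Cells and cores -/

/-- Cells are measurable. -/
private theorem measurableSet_c9Cell' (S : ℝ) (m : ℕ) (j : Fin 3 → Fin m) : MeasurableSet (c9Cell S m j) := by
  have h : c9Cell S m j = ⋂ i, (fun y : V3 => y i) ⁻¹'
      Ioc (-S / 2 + ((j i : ℕ) : ℝ) * (S / m)) (-S / 2 + (((j i : ℕ) : ℝ) + 1) * (S / m)) := by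
    ext y
    simp only [c9Cell, mem_setOf_eq, mem_iInter, mem_preimage]
  rw [h]
  exact MeasurableSet.iInter fun i => measurableSet_Ioc.preimage (by fun_prop)

/-- Cells are bounded. -/
private theorem isBounded_c9Cell' (S : ℝ) (m : ℕ) (j : Fin 3 → Fin m) : Bornology.IsBounded (c9Cell S m j) :=
  Literature.MathematicalPhysics.StatisticalMechanics.isBounded_of_forall_mem_Icc
    (a := fun i => -S / 2 + ((j i : ℕ) : ℝ) * (S / m)) (b := fun i => -S / 2 + (((j i : ℕ) : ℝ) + 1) * (S / m))
    fun _ hy i => Ioc_subset_Icc_self (hy i)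

/-- Cores are measurable. -/
theorem measurableSet_c9CellCore (S : ℝ) (m : ℕ) (j : Fin 3 → Fin m) : MeasurableSet (c9CellCore S m j) := by
  have h : c9CellCore S m j = ⋂ i, (fun y : V3 => y i) ⁻¹'
      Icc (-S / 2 + ((j i : ℕ) : ℝ) * (S / m) + 1) (-S / 2 + (((j i : ℕ) : ℝ) + 1) * (S / m) - 1) := by
    ext y
    simp only [c9CellCore, mem_setOf_eq, mem_iInter, mem_preimage]
  rw [h]
  exact MeasurableSet.iInter fun i => measurableSet_Icc.preimage (by fun_prop)

/-- The core of a cell lies in the cell. -/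
theorem c9CellCore_subset_c9Cell (S : ℝ) (m : ℕ) (j : Fin 3 → Fin m) : c9CellCore S m j ⊆ c9Cell S m j :=
  fun y hy i => by
    obtain ⟨h1, h2⟩ := hy i
    exact ⟨by linarith, by linarith⟩

/-! ## Geometry: the periodic distance across cells and within a cell -/

/-- **Points of the core of a cell are at periodic distance `≥ 1` from the points of every OTHER cell**: in a
coordinate `i` with `j i ≠ j' i` the core interval `[l_i + 1, l_i + S/m - 1]` and the cell interval `(l'_i, l'_i + S/m]`
give `1 ≤ |d_i| ≤ S - 1`, so `min |d_i| (S - |d_i|) ≥ 1`, and one summand suffices. -/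
theorem one_le_c9PerSqDist_of_mem_core_of_ne {S : ℝ} (hS : 0 < S) {m : ℕ} {j j' : Fin 3 → Fin m} (hjj' : j ≠ j')
    {y y' : V3} (hy : y ∈ c9CellCore S m j) (hy' : y' ∈ c9Cell S m j') : 1 ≤ c9PerSqDist S y y' := by
  obtain ⟨i, hi⟩ := Function.ne_iff.1 hjj'
  have hm0 : (0 : ℝ) < m := Nat.cast_pos.2 (Fin.pos (j i))
  have hL0 : 0 ≤ S / m := div_nonneg hS.le hm0.le
  have hLm : (m : ℝ) * (S / m) = S := mul_div_cancel₀ _ hm0.ne'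
  have ha : ((j i : ℕ) : ℝ) + 1 ≤ m := by
    have h : (j i : ℕ) + 1 ≤ m := (j i).2
    exact_mod_cast h
  have hb : ((j' i : ℕ) : ℝ) + 1 ≤ m := by
    have h : (j' i : ℕ) + 1 ≤ m := (j' i).2
    exact_mod_cast h
  have ha0 : (0 : ℝ) ≤ (j i : ℕ) := Nat.cast_nonneg _
  have hb0 : (0 : ℝ) ≤ (j' i : ℕ) := Nat.cast_nonneg _
  have haS : (((j i : ℕ) : ℝ) + 1) * (S / m) ≤ S := by
    calc (((j i : ℕ) : ℝ) + 1) * (S / m) ≤ m * (S / m) := mul_le_mul_of_nonneg_right ha hL0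
      _ = S := hLm
  have hbS : (((j' i : ℕ) : ℝ) + 1) * (S / m) ≤ S := by
    calc (((j' i : ℕ) : ℝ) + 1) * (S / m) ≤ m * (S / m) := mul_le_mul_of_nonneg_right hb hL0
      _ = S := hLm
  have haL : 0 ≤ ((j i : ℕ) : ℝ) * (S / m) := mul_nonneg ha0 hL0
  have hbL : 0 ≤ ((j' i : ℕ) : ℝ) * (S / m) := mul_nonneg hb0 hL0
  obtain ⟨h1, h2⟩ := hy i
  obtain ⟨h1', h2'⟩ := hy' i
  -- the periodic coordinate distance in the coordinate `i` is `≥ 1`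
  have key : 1 ≤ min |y i - y' i| (S - |y i - y' i|) := by
    rcases Nat.lt_or_gt_of_ne (Fin.val_ne_of_ne hi) with hlt | hlt
    · have hle : (((j i : ℕ) : ℝ) + 1) * (S / m) ≤ ((j' i : ℕ) : ℝ) * (S / m) :=
        mul_le_mul_of_nonneg_right (by exact_mod_cast hlt) hL0
      have hd1 : y i - y' i ≤ -1 := by linarith
      have hd2 : 1 - S ≤ y i - y' i := by linarith
      rw [abs_of_neg (by linarith)]
      exact le_min (by linarith) (by linarith)
    · have hle : (((j' i : ℕ) : ℝ) + 1) * (S / m) ≤ ((j i : ℕ) : ℝ) * (S / m) :=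
        mul_le_mul_of_nonneg_right (by exact_mod_cast hlt) hL0
      have hd1 : 1 ≤ y i - y' i := by linarith
      have hd2 : y i - y' i ≤ S - 1 := by linarith
      rw [abs_of_pos (by linarith)]
      exact le_min hd1 (by linarith)
  -- one summand suffices
  show 1 ≤ ∑ i, (min |y i - y' i| (S - |y i - y' i|)) ^ 2
  refine le_trans ?_ (Finset.single_le_sum (f := fun i => (min |y i - y' i| (S - |y i - y' i|)) ^ 2)
    (fun i _ => sq_nonneg _) (Finset.mem_univ i))
  exact one_le_pow₀ key

/-- **Distinct hard spheres of the SAME cell are at periodic distance `≥ 1`** (`m ≥ 2`): their coordinates differ by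
less than `S/m ≤ S/2`, so the periodic coordinate distances are the Euclidean ones, whose squares sum to
`‖y - y'‖² ≥ 1`. -/
theorem one_le_c9PerSqDist_of_mem_cell {S : ℝ} (hS : 0 < S) {m : ℕ} (hm : 2 ≤ m) {j : Fin 3 → Fin m} {y y' : V3}
    (hy : y ∈ c9Cell S m j) (hy' : y' ∈ c9Cell S m j) (h : 1 ≤ ‖y - y'‖) : 1 ≤ c9PerSqDist S y y' := by
  have hm2 : (2 : ℝ) ≤ m := by exact_mod_cast hm
  have hL2 : S / m ≤ S / 2 := div_le_div_of_nonneg_left hS.le two_pos hm2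
  have hcoord : ∀ i, min |y i - y' i| (S - |y i - y' i|) = |y i - y' i| := fun i => by
    obtain ⟨h1, h2⟩ := hy i
    obtain ⟨h1', h2'⟩ := hy' i
    refine min_eq_left ?_
    have hle : |y i - y' i| ≤ S / 2 := by
      rw [abs_le]
      constructor <;> linarith
    linarith
  have h2 : (1 : ℝ) ≤ ‖y - y'‖ ^ 2 := one_le_pow₀ h
  rw [EuclideanSpace.real_norm_sq_eq] at h2
  unfold c9PerSqDist
  calc (1 : ℝ) ≤ ∑ i, (y - y') i ^ 2 := h2
    _ = ∑ i, (min |y i - y' i| (S - |y i - y' i|)) ^ 2 := Finset.sum_congr rfl fun i _ => by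
        rw [hcoord i, sq_abs, PiLp.sub_apply]

/-- **The geometry of the collar trick**: tuples of cell configurations that are unit hard core, carried by their cell,
void on the collar of their cell and with counts `k_j`, `∑ k_j = n`, belong to `c9TorusHardCoreTuples S m n`. -/
theorem pi_subset_c9TorusHardCoreTuples {S : ℝ} (hS : 0 < S) {m : ℕ} (hm : 2 ≤ m) (n : ℕ) (k : (Fin 3 → Fin m) → ℕ)
    (hk : ∑ j, k j = n) :
    Set.pi univ (fun j => ({ω : PointConfig (V3 × V3) | ω.count (Prod.fst ⁻¹' (c9Cell S m j \ c9CellCore S m j)) = 0} ∩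
        {ω | ω.count univ = (k j : ℕ∞)}) ∩
      ({ω | IsHardCore 1 ω} ∩ {ω | ω.count (Prod.fst ⁻¹' (c9Cell S m j)ᶜ) = 0})) ⊆ c9TorusHardCoreTuples S m n := by
  intro t ht
  have hA : ∀ j, ((t j).count (Prod.fst ⁻¹' (c9Cell S m j \ c9CellCore S m j)) = 0 ∧ (t j).count univ = (k j : ℕ∞)) ∧
      (IsHardCore 1 (t j) ∧ (t j).count (Prod.fst ⁻¹' (c9Cell S m j)ᶜ) = 0) := fun j => ht j (mem_univ j)
  -- every particle of `t j` has its position in the core of the cell `j`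
  have hcell : ∀ j, ∀ p ∈ t j, p.1 ∈ c9Cell S m j := fun j p hp => by
    by_contra h
    exact (count_eq_zero_iff'.1 (hA j).2.2) p hp h
  have hcore : ∀ j, ∀ p ∈ t j, p.1 ∈ c9CellCore S m j := fun j p hp => by
    by_contra h
    exact (count_eq_zero_iff'.1 (hA j).1.1) p hp ⟨hcell j p hp, h⟩
  refine ⟨?_, fun j j' p q hp hq hjpq => ?_⟩
  · rw [Finset.sum_congr rfl fun j _ => (hA j).1.2, ← Nat.cast_sum, hk]
  · by_cases hjj' : j = j'
    · subst hjj'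
      have hpq : p ≠ q := hjpq.resolve_left fun h => h rfl
      exact one_le_c9PerSqDist_of_mem_cell hS hm (hcell j p hp) (hcell j q hq) ((hA j).2.1 p hp q hq hpq)
    · exact one_le_c9PerSqDist_of_mem_core_of_ne hS hjj' (hcore j p hp) (hcell j' q hq)

/-! ## The free law is carried by hard-core configurations -/

/-- **The free finite-volume law is carried by hard-core configurations**: `γ_Λ({hard core}ᶜ | ∅) = 0` for a bounded
measurable `Λ` (the free law is the Poisson-form specification `hsLocalSpec`, conditioned on the hard core). -/
theorem gibbsSpecMeasure_empty_compl_isHardCore_eq_zero {z β : ℝ} (hz : 0 ≤ z) (hβ : 0 < β) (u : V3) {Λ : Set V3}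
    (hΛ : MeasurableSet Λ) (hΛb : Bornology.IsBounded Λ) :
    gibbsSpecMeasure 1 z β u Λ ∅ {X : PointConfig (V3 × V3) | IsHardCore 1 X}ᶜ = 0 := by
  have h := hsLocalSpec_ae_isHardCore (1 : ℝ) ((Real.toNNReal z) • ((volume : Measure V3).prod
    ((volume : Measure V3).withDensity fun v => ENNReal.ofReal (maxwellianBeta β (v - u))))) Λ ∅
  rw [← gibbsSpecMeasure_empty_eq_hsLocalSpec hz hβ u hΛ hΛb, ae_iff] at h
  rw [compl_setOf]
  exact h

/-! ## The collar trick in one cell -/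

/-- **The collar trick in one cell.** For measurable `W ⊆ Λ`, `Λ` bounded measurable, `z ≥ 0`, `β > 0` and every `n`:
`e^{-z vol(Λ \ W)} · γ_W({N = n} | ∅) ≤ γ_Λ({no particle above Λ \ W} ∩ {N = n} | ∅)`. Consistency of the free
specification in `W` (`lintegral_gibbsSpec_gibbsSpecMeasure_empty`), restricted to the boundary conditions with no
particle above `Λ \ W` and none above `Λᶜ`: all their particles lie above `W`, so the superposition in `W` does not see
them and `γ_W(· | η) = γ_W(· | ∅)`; then the void bound `ofReal_exp_neg_le_gibbsSpecMeasure_empty_void` for `Λ \ W`, and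
`γ_W(· | ∅)` is carried by configurations above `W` (which have no particle above `Λ \ W`). -/
theorem exp_neg_mul_core_count_le_cell {z β : ℝ} {u : V3} (hz : 0 ≤ z) (hβ : 0 < β) {Λ W : Set V3}
    (hΛ : MeasurableSet Λ) (hΛb : Bornology.IsBounded Λ) (hW : MeasurableSet W) (hWΛ : W ⊆ Λ) (n : ℕ) :
    ENNReal.ofReal (Real.exp (-(z * (volume (Λ \ W)).toReal))) *
        gibbsSpecMeasure 1 z β u W ∅ {ω | ω.count univ = (n : ℕ∞)} ≤
      gibbsSpecMeasure 1 z β u Λ ∅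
        ({ω | ω.count (Prod.fst ⁻¹' (Λ \ W)) = 0} ∩ {ω | ω.count univ = (n : ℕ∞)}) := by
  have hKm : MeasurableSet (Λ \ W) := hΛ.diff hW
  set V : Set (PointConfig (V3 × V3)) := {X | X.count (Prod.fst ⁻¹' (Λ \ W)) = 0} with hV
  set C : Set (PointConfig (V3 × V3)) := {X | X.count (Prod.fst ⁻¹' Λᶜ) = 0} with hC
  set Nn : Set (PointConfig (V3 × V3)) := {ω | ω.count univ = (n : ℕ∞)} with hNn
  have hVm : MeasurableSet V := measurableSet_count_eq_zero (hKm.preimage measurable_fst)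
  have hCm : MeasurableSet C := measurableSet_count_eq_zero (hΛ.compl.preimage measurable_fst)
  have hBm : MeasurableSet (V ∩ Nn) := hVm.inter (measurableSet_countUniv_eq n)
  -- boundary conditions in `V ∩ C` have all their particles above `W`: the specification of `W` does not see them
  have hspec : ∀ η ∈ V ∩ C, gibbsSpec 1 z β u W η (V ∩ Nn) = gibbsSpecMeasure 1 z β u W ∅ (V ∩ Nn) := by
    rintro η ⟨hηV, hηC⟩
    have hηW : ∀ p ∈ η, p.1 ∈ W := fun p hp => by
      have hpΛ : p.1 ∈ Λ := by
        by_contra h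
        exact (count_eq_zero_iff'.1 hηC) p hp h
      by_contra h
      exact (count_eq_zero_iff'.1 hηV) p hp ⟨hpΛ, h⟩
    have hsup : ∀ (k : ℕ) (x : Fin k → V3 × V3), superposeIn W x η = superposeIn W x ∅ := fun k x => by
      ext p
      rw [mem_superposeIn_iff, mem_superposeIn_iff]
      constructor
      · rintro (h | ⟨hp, hpW⟩)
        · exact Or.inl h
        · exact absurd (hηW p hp) hpW
      · rintro (h | ⟨hp, -⟩)
        · exact Or.inl h
        · exact absurd hp (notMem_empty' p)
    have hw : ∀ B, gibbsWeight 1 z β u W η B = gibbsWeight 1 z β u W ∅ B := fun B => by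
      unfold Literature.Analysis.FluidPDE.gibbsWeight
      refine tsum_congr fun k => ?_
      congr 1
      refine lintegral_congr fun x => ?_
      rw [hsup k x]
    rw [gibbsSpecMeasure_apply 1 z β u hW ∅ hBm]
    unfold Literature.Analysis.FluidPDE.gibbsSpec
    rw [hw, hw]
  -- the free law of `W` does not distinguish `V ∩ {N = n}` from `{N = n}`
  have hWB : gibbsSpecMeasure 1 z β u W ∅ Nn ≤ gibbsSpecMeasure 1 z β u W ∅ (V ∩ Nn) := by
    rw [← measure_inter_conull (gibbsSpecMeasure_empty_compl_count_eq_zero 1 z β u hW)]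
    refine measure_mono ?_
    rintro X ⟨hXN, hXC⟩
    refine ⟨?_, hXN⟩
    change X.count (Prod.fst ⁻¹' (Λ \ W)) = 0
    have hXC' : X.count (Prod.fst ⁻¹' Wᶜ) = 0 := hXC
    rw [count_eq_zero_iff'] at hXC' ⊢
    exact fun p hp hpK => hXC' p hp ((mem_sdiff p.1).1 hpK).2
  -- the void bound for `Λ \ W`, and `C` has full measure
  have hvoid : ENNReal.ofReal (Real.exp (-(z * (volume (Λ \ W)).toReal))) ≤ gibbsSpecMeasure 1 z β u Λ ∅ V :=
    ofReal_exp_neg_le_gibbsSpecMeasure_empty_void hz hβ hΛ hΛb hKm sdiff_subset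
  have hCfull : gibbsSpecMeasure 1 z β u Λ ∅ Cᶜ = 0 := gibbsSpecMeasure_empty_compl_count_eq_zero 1 z β u hΛ
  rw [← lintegral_gibbsSpec_gibbsSpecMeasure_empty (ε := 1) hz hβ u hΛ hΛb hW hWΛ hBm]
  calc ENNReal.ofReal (Real.exp (-(z * (volume (Λ \ W)).toReal))) * gibbsSpecMeasure 1 z β u W ∅ Nn
      ≤ gibbsSpecMeasure 1 z β u Λ ∅ V * gibbsSpecMeasure 1 z β u W ∅ (V ∩ Nn) := mul_le_mul' hvoid hWB
    _ = gibbsSpecMeasure 1 z β u W ∅ (V ∩ Nn) * gibbsSpecMeasure 1 z β u Λ ∅ (V ∩ C) := by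
        rw [mul_comm, measure_inter_conull hCfull]
    _ = ∫⁻ η, (V ∩ C).indicator (fun _ => gibbsSpecMeasure 1 z β u W ∅ (V ∩ Nn)) η ∂(gibbsSpecMeasure 1 z β u Λ ∅) :=
        (lintegral_indicator_const (hVm.inter hCm) _).symm
    _ ≤ ∫⁻ η, gibbsSpec 1 z β u W η (V ∩ Nn) ∂(gibbsSpecMeasure 1 z β u Λ ∅) :=
        lintegral_mono fun η => by
          by_cases hη : η ∈ V ∩ C
          · rw [indicator_of_mem hη, hspec η hη]
          · rw [indicator_of_notMem hη]
            exact zero_le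

/-! ## The registered stub -/

/-- Registered stub `c9_pi_free_torusHardCoreTuples_ge` (line `FirstLemma`, piece (B5), **the collar trick**): the
product of the free cell measures charges the torus-hard-core tuples with prescribed total number at least as much as
the product over the cells of (void collar) × (exact count in the core),
`∏_j e^{-z vol(cell_j \ core_j)} γ_{core_j}{N = k_j} ≤ (⊗_j γ_{cell_j})(c9TorusHardCoreTuples S m n)` for `∑ k_j = n`.
Monotonicity along `∏_j A_j ⊆ E` (`pi_subset_c9TorusHardCoreTuples`, the hard core and carrier events having full
measure), `Measure.pi_pi`, and the one-cell bound `exp_neg_mul_core_count_le_cell` in every cell. -/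
theorem c9_pi_free_torusHardCoreTuples_ge {z β : ℝ} {u : V3} (hz : 0 ≤ z) (hβ : 0 < β) {S : ℝ} (hS : 0 < S) {m : ℕ}
    (hm : 2 ≤ m) (n : ℕ) (k : (Fin 3 → Fin m) → ℕ) (hk : ∑ j, k j = n) :
    ∏ j, ENNReal.ofReal (Real.exp (-(z * (volume (c9Cell S m j \ c9CellCore S m j)).toReal))) *
        gibbsSpecMeasure 1 z β u (c9CellCore S m j) ∅ {ω | ω.count univ = k j} ≤
      (Measure.pi fun j : Fin 3 → Fin m => gibbsSpecMeasure 1 z β u (c9Cell S m j) ∅) (c9TorusHardCoreTuples S m n) := by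
  have hΛm : ∀ j : Fin 3 → Fin m, MeasurableSet (c9Cell S m j) := fun j => measurableSet_c9Cell' S m j
  have hΛb : ∀ j : Fin 3 → Fin m, Bornology.IsBounded (c9Cell S m j) := fun j => isBounded_c9Cell' S m j
  haveI : ∀ j : Fin 3 → Fin m, IsProbabilityMeasure (gibbsSpecMeasure 1 z β u (c9Cell S m j) ∅) := fun j =>
    isProbabilityMeasure_gibbsSpecMeasure_empty hz hβ u (hΛm j) (hΛb j).measure_lt_top.ne
  -- the good events, cell by cell
  set A : (Fin 3 → Fin m) → Set (PointConfig (V3 × V3)) := fun j =>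
    ({ω : PointConfig (V3 × V3) | ω.count (Prod.fst ⁻¹' (c9Cell S m j \ c9CellCore S m j)) = 0} ∩
        {ω | ω.count univ = (k j : ℕ∞)}) ∩
      ({ω | IsHardCore 1 ω} ∩ {ω | ω.count (Prod.fst ⁻¹' (c9Cell S m j)ᶜ) = 0}) with hA
  have hfull : ∀ j : Fin 3 → Fin m, gibbsSpecMeasure 1 z β u (c9Cell S m j) ∅
      ({ω : PointConfig (V3 × V3) | IsHardCore 1 ω} ∩ {ω | ω.count (Prod.fst ⁻¹' (c9Cell S m j)ᶜ) = 0})ᶜ = 0 :=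
    fun j => by
      rw [compl_inter]
      exact measure_union_null (gibbsSpecMeasure_empty_compl_isHardCore_eq_zero hz hβ u (hΛm j) (hΛb j))
        (gibbsSpecMeasure_empty_compl_count_eq_zero 1 z β u (hΛm j))
  calc ∏ j, ENNReal.ofReal (Real.exp (-(z * (volume (c9Cell S m j \ c9CellCore S m j)).toReal))) *
        gibbsSpecMeasure 1 z β u (c9CellCore S m j) ∅ {ω | ω.count univ = (k j : ℕ∞)}
      ≤ ∏ j, gibbsSpecMeasure 1 z β u (c9Cell S m j) ∅ (A j) := Finset.prod_le_prod' fun j _ => by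
        simp only [hA]
        rw [measure_inter_conull (hfull j)]
        exact exp_neg_mul_core_count_le_cell hz hβ (hΛm j) (hΛb j) (measurableSet_c9CellCore S m j)
          (c9CellCore_subset_c9Cell S m j) (k j)
    _ = (Measure.pi fun j : Fin 3 → Fin m => gibbsSpecMeasure 1 z β u (c9Cell S m j) ∅) (Set.pi univ A) :=
        (Measure.pi_pi _ A).symm
    _ ≤ (Measure.pi fun j : Fin 3 → Fin m => gibbsSpecMeasure 1 z β u (c9Cell S m j) ∅) (c9TorusHardCoreTuples S m n) :=
        measure_mono (pi_subset_c9TorusHardCoreTuples hS hm n k hk)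

end Summit.AtomisticToContinuum.HydrodynamicLimit.Theorems.KiferCompactification

end
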